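import Literature.NumberTheory.DiophantineGeometry.XYZConjecture
import Literature.NumberTheory.Sieve.SmoothABCPairs
import HarnessLib

/-!
# Harper's Corollary 1 ⟹ the finiteness half `κ₀ < ∞` of the xyz conjecture (the reduction, proved)

Topic `NumberTheory/DiophantineGeometry`; PROOF companion of `XYZConjecture.lean` (the xyz conjecture
record: `XYZ.smoothness`, `XYZ.smoothTriples`, `XYZ.ExponentLE`, the named fact `XYZUpperHalf`).
Everything in this file is PROVED; no definition, no named fact.

## Source and what is formalized

A. J. Harper, *Minor arcs, mean values, and restriction theory for exponential sums over smooth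
numbers*, Compositio Math. 152 (2016) 1121–1158 [Harper2016] (= arXiv:1408.1662, READ §1, §5).
Corollary 1 (§1): "There exists a large absolute constant `K > 0` such that, for any large
`logᴷ x ≤ y ≤ x`, `#{(a,b,c) ∈ 𝒮(y)³ : a, b, c ≤ x, a + b = c} = Ψ(x,y)³/(2x) · (1 + O(log(u+1)/log y))`",
followed by the remark "Corollary 1 now proves unconditionally that Lagarias and Soundararajan's
'xyz-smoothness exponent' is at most `K`, and in particular is finite", with the footnote
"Strictly speaking, Lagarias and Soundararajan need `a, b, c` to be coprime, but a simple
inclusion–exclusion argument as in §8 of their paper can be used to impose that condition."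

This file proves that LAST STEP — from a count of (not necessarily coprime) smooth solutions of
`a + b = c` in a box to property (b) of the xyz conjecture — in the following form, which needs
no inclusion–exclusion because only infinitude (not an asymptotic) is wanted:

* `XYZ.exponentLE_of_frequently_le_ncard` — if for some `K : ℕ`, `δ > 0` and arbitrarily large
  `x` there are at least `x^{1+δ}` pairs `(a, b)`, `a, b ≥ 1`, `a + b ≤ x`, with every prime factor
  of `ab(a+b)` at most `(log x)^K` (for `y = logᴷ x` Corollary 1 gives `≍ Ψ(x,y)³/x = x^{2-3/K+o(1)}`
  of them, since `Ψ(x, logᴷ x) = x^{1-1/K+o(1)}`), then `XYZ.ExponentLE K` ("`κ₀ ≤ K`");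
* `xyzUpperHalf_of_frequently_le_ncard` — hence `XYZUpperHalf`.

Proof (primitive parts and a pigeonhole): `(a, b) ↦ (a/g, b/g, g)`, `g = gcd(a, b)`, is injective and
sends a smooth solution to an abc triple `a/g + b/g = (a+b)/g` whose largest prime factor is still
`≤ (log x)^K` (`XYZ.isABCTriple_div_gcd`, `XYZ.smoothness_div_gcd_le`); if all these triples had height
`(a+b)/g < x^{δ/4}`, the solutions would number at most `(x^{δ/4} + 1)² (x + 1) ≤ 8 x^{1+δ/2} < x^{1+δ}`
(`XYZ.ncard_le_of_height_div_gcd_le`); and a triple of height `c' ≥ x^{δ/4}` has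
`S ≤ (log x)^K = (4/δ)^K ((δ/4) log x)^K ≤ (4/δ)^K (log c')^K < (log c')^{K+ε}` once `((δ/4) log x)^ε > (4/δ)^K`
(`XYZ.lt_rpow_log_of_le_log_pow`). So abc triples in `{S < (log c)^{K+ε}}` exist with arbitrarily large `c`.

NOT here: Corollary 1 itself (the circle method with Harper's Theorems 1–2 and Drappeau's major-arc
estimates — the analytic core behind the named fact `XYZUpperHalf`, not vendored), nor the lower bound
`Ψ(x, logᴷ x) ≥ x^{1-1/K+o(1)}`.

## References

* [Harper2016] A. J. Harper, Compositio Math. 152 (2016) 1121–1158, Cor. 1 and the remark and footnote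
  following it (§1); proof of Cor. 1 in §5 (arXiv:1408.1662).
* [LagariasSoundararajan2011] J. C. Lagarias, K. Soundararajan, JTNB 23 (2011) 209–234, §1.1 (property (b)).
-/

noncomputable section

open Real Filter

namespace Literature.NumberTheory.DiophantineGeometry

namespace XYZ

variable {a b : ℕ}

/-! ### Primitive parts of solutions of `a + b = c` -/

/-- Dividing a solution `a + b = c` (`a, b ≥ 1`) by `g = gcd(a, b)` gives an abc triple
`a/g + b/g = (a + b)/g`. [folklore] -/
theorem isABCTriple_div_gcd (ha : 0 < a) (hb : 0 < b) :
    IsABCTriple (a / Nat.gcd a b) (b / Nat.gcd a b) ((a + b) / Nat.gcd a b) := by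
  have hg : 0 < Nat.gcd a b := Nat.gcd_pos_of_pos_left b ha
  refine ⟨Nat.div_pos (Nat.gcd_le_left b ha) hg, Nat.div_pos (Nat.gcd_le_right _ hb) hg,
    (Nat.add_div_of_dvd_right (Nat.gcd_dvd_left a b)).symm, Nat.coprime_div_gcd_div_gcd hg⟩

/-- The primitive part `(a/g, b/g, (a+b)/g)` of a solution divides it coordinatewise, so a bound for
the prime factors of `ab(a + b)` bounds its smoothness `S`. [folklore] -/
theorem smoothness_div_gcd_le {Y : ℝ} (ha : 0 < a) (hb : 0 < b)
    (hsm : ∀ q : ℕ, q.Prime → q ∣ a * b * (a + b) → (q : ℝ) ≤ Y) :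
    (smoothness (a / Nat.gcd a b) (b / Nat.gcd a b) ((a + b) / Nat.gcd a b) : ℝ) ≤ Y := by
  have hmem := smoothness_mem_primeFactors (isABCTriple_div_gcd ha hb)
  refine hsm _ (Nat.prime_of_mem_primeFactors hmem) ((Nat.dvd_of_mem_primeFactors hmem).trans ?_)
  exact mul_dvd_mul (mul_dvd_mul (Nat.div_dvd_of_dvd (Nat.gcd_dvd_left a b))
    (Nat.div_dvd_of_dvd (Nat.gcd_dvd_right a b)))
    (Nat.div_dvd_of_dvd (dvd_add (Nat.gcd_dvd_left a b) (Nat.gcd_dvd_right a b)))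

/-- **Pigeonhole on primitive parts.** `(a, b) ↦ (a/g, b/g, g)` is injective, so a set of pairs
`(a, b)` with `a ≥ 1`, `a + b ≤ x` and primitive height `(a + b)/g ≤ z` has at most
`(z + 1)² (x + 1)` elements. [folklore] -/
theorem ncard_le_of_height_div_gcd_le {T : Set (ℕ × ℕ)} {x z : ℕ}
    (hT : ∀ p ∈ T, 0 < p.1 ∧ p.1 + p.2 ≤ x ∧ (p.1 + p.2) / Nat.gcd p.1 p.2 ≤ z) :
    T.ncard ≤ (z + 1) * ((z + 1) * (x + 1)) := by
  classical
  let f : ℕ × ℕ → ℕ × ℕ × ℕ := fun p =>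
    (p.1 / Nat.gcd p.1 p.2, p.2 / Nat.gcd p.1 p.2, Nat.gcd p.1 p.2)
  have hf : Function.Injective f := by
    rintro ⟨a₁, b₁⟩ ⟨a₂, b₂⟩ hpq
    simp only [f, Prod.mk.injEq] at hpq
    obtain ⟨h1, h2, h3⟩ := hpq
    have ea₁ := Nat.div_mul_cancel (Nat.gcd_dvd_left a₁ b₁)
    have eb₁ := Nat.div_mul_cancel (Nat.gcd_dvd_right a₁ b₁)
    have ea₂ := Nat.div_mul_cancel (Nat.gcd_dvd_left a₂ b₂)
    have eb₂ := Nat.div_mul_cancel (Nat.gcd_dvd_right a₂ b₂)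
    rw [h1, h3] at ea₁
    rw [h2, h3] at eb₁
    rw [Prod.mk.injEq]
    exact ⟨ea₁.symm.trans ea₂, eb₁.symm.trans eb₂⟩
  calc T.ncard
      ≤ (↑(Finset.range (z + 1) ×ˢ (Finset.range (z + 1) ×ˢ Finset.range (x + 1))) :
          Set (ℕ × ℕ × ℕ)).ncard := by
        refine Set.ncard_le_ncard_of_injOn f (fun p hp => ?_) hf.injOn (Finset.finite_toSet _)
        obtain ⟨h0, hx, hz⟩ := hT p hp
        have hg : Nat.gcd p.1 p.2 ≤ x := (Nat.gcd_le_left p.2 h0).trans ((Nat.le_add_right _ _).trans hx)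
        have h1 : p.1 / Nat.gcd p.1 p.2 ≤ z :=
          (Nat.div_le_div_right (Nat.le_add_right p.1 p.2)).trans hz
        have h2 : p.2 / Nat.gcd p.1 p.2 ≤ z :=
          (Nat.div_le_div_right (Nat.le_add_left p.2 p.1)).trans hz
        simp only [f, Finset.coe_product, Finset.coe_range, Set.mem_prod, Set.mem_Iio]
        omega
    _ = (z + 1) * ((z + 1) * (x + 1)) := by
        rw [Set.ncard_coe_finset, Finset.card_product, Finset.card_product, Finset.card_range,
          Finset.card_range]

/-! ### The exponent bookkeeping -/

/-- If `S ≤ (log X)^K`, `X^{δ/4} ≤ C` and `((δ/4) log X)^ε > (4/δ)^K` (with `(δ/4) log X > 1`), then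
`S < (log C)^{K+ε}`: indeed `(log X)^K = (4/δ)^K ((δ/4) log X)^K ≤ (4/δ)^K (log C)^K < (log C)^ε (log C)^K`.
[folklore] -/
theorem lt_rpow_log_of_le_log_pow {K : ℕ} {δ ε S X C : ℝ} (hδ : 0 < δ) (hε : 0 < ε) (hX : 0 < X)
    (h1 : 1 < δ / 4 * Real.log X) (h4 : (4 / δ) ^ K < (δ / 4 * Real.log X) ^ ε)
    (hC : X ^ (δ / 4) ≤ C) (hS : S ≤ Real.log X ^ K) :
    S < Real.log C ^ ((K : ℝ) + ε) := by
  set L₀ : ℝ := δ / 4 * Real.log X with hL₀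
  have hL₀0 : 0 < L₀ := zero_lt_one.trans h1
  have hXC : 0 < X ^ (δ / 4) := Real.rpow_pos_of_pos hX _
  have hLC : L₀ ≤ Real.log C := by
    calc L₀ = Real.log (X ^ (δ / 4)) := by rw [Real.log_rpow hX, hL₀]
      _ ≤ Real.log C := Real.log_le_log hXC hC
  have hL0 : 0 < Real.log C := hL₀0.trans_le hLC
  have hlogX : Real.log X = 4 / δ * L₀ := by
    rw [hL₀]; field_simp
  have hK : Real.log X ^ K ≤ (4 / δ) ^ K * Real.log C ^ K := by
    rw [hlogX, mul_pow]
    exact mul_le_mul_of_nonneg_left (pow_le_pow_left₀ hL₀0.le hLC K) (by positivity)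
  have hεC : (4 / δ) ^ K < Real.log C ^ ε :=
    h4.trans_le (Real.rpow_le_rpow hL₀0.le hLC hε.le)
  have hpowC : 0 < Real.log C ^ K := pow_pos hL0 K
  calc S ≤ (4 / δ) ^ K * Real.log C ^ K := hS.trans hK
    _ < Real.log C ^ ε * Real.log C ^ K := mul_lt_mul_of_pos_right hεC hpowC
    _ = Real.log C ^ ((K : ℝ) + ε) := by
        rw [Real.rpow_add hL0, Real.rpow_natCast, mul_comm]

/-! ### Harper's remark: Corollary 1 ⟹ `κ₀ ≤ K` -/

/-- **Harper's Corollary 1 (weak counting form) ⟹ property (b) at `K`, "`κ₀ ≤ K`"**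
[Harper2016, §1, remark and footnote after Cor. 1]. If for some `δ > 0` and arbitrarily large `x`
at least `x^{1+δ}` pairs `(a, b)` with `a, b ≥ 1`, `a + b ≤ x` have all prime factors of `ab(a+b)`
at most `(log x)^K` — for `y = logᴷ x` and `K` large, Corollary 1 supplies
`Ψ(x,y)³/(2x) · (1 + O(1/K)) = x^{2-3/K+o(1)}` of them — then for every `ε > 0` infinitely many abc
triples have `S(a, b, c) < (log c)^{K+ε}`. Proof: primitive parts and a pigeonhole (module
docstring); the source's inclusion–exclusion is not needed for infinitude.
[cite: Harper2016, §1 (remark and footnote following Cor. 1: "xyz-smoothness exponent is at most K")] -/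
theorem exponentLE_of_frequently_le_ncard {K : ℕ} {δ : ℝ} (hδ : 0 < δ)
    (h : ∃ᶠ x : ℕ in atTop, (x : ℝ) ^ (1 + δ) ≤
      ({p : ℕ × ℕ | 0 < p.1 ∧ 0 < p.2 ∧ p.1 + p.2 ≤ x ∧ ∀ q : ℕ, q.Prime →
        q ∣ p.1 * p.2 * (p.1 + p.2) → (q : ℝ) ≤ Real.log x ^ K}.ncard : ℝ)) :
    ExponentLE K := by
  intro ε hε
  -- it suffices to produce triples of arbitrarily large height
  suffices H : ∀ N : ℕ, ∃ t ∈ smoothTriples ((K : ℝ) + ε), N < t.2.2 by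
    intro hfin
    obtain ⟨N, hN⟩ := (hfin.image fun t => t.2.2).bddAbove
    obtain ⟨t, ht, hlt⟩ := H N
    exact absurd (hN (Set.mem_image_of_mem (fun t => t.2.2) ht)) (not_le.mpr hlt)
  intro N
  -- largeness conditions on `x`, all eventually true
  have hcast : Tendsto (fun x : ℕ => (x : ℝ)) atTop atTop := tendsto_natCast_atTop_atTop
  have hL : Tendsto (fun x : ℕ => δ / 4 * Real.log x) atTop atTop :=
    (Real.tendsto_log_atTop.comp hcast).const_mul_atTop (by positivity)
  have E1 : ∀ᶠ x : ℕ in atTop, (3 : ℝ) ≤ x := hcast.eventually_ge_atTop 3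
  have E2 : ∀ᶠ x : ℕ in atTop, (8 : ℝ) < (x : ℝ) ^ (δ / 2) :=
    ((tendsto_rpow_atTop (by positivity)).comp hcast).eventually_gt_atTop 8
  have E3 : ∀ᶠ x : ℕ in atTop, (N : ℝ) < (x : ℝ) ^ (δ / 4) :=
    ((tendsto_rpow_atTop (by positivity)).comp hcast).eventually_gt_atTop (N : ℝ)
  have E4 : ∀ᶠ x : ℕ in atTop, (4 / δ) ^ K < (δ / 4 * Real.log x) ^ ε :=
    ((tendsto_rpow_atTop hε).comp hL).eventually_gt_atTop _
  have E5 : ∀ᶠ x : ℕ in atTop, (1 : ℝ) < δ / 4 * Real.log x := hL.eventually_gt_atTop 1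
  obtain ⟨x, hx, h3, h8, hN, h4, h1⟩ :=
    (h.and_eventually (E1.and (E2.and (E3.and (E4.and E5))))).exists
  have hx0 : (0 : ℝ) < x := by linarith
  have hx1 : (1 : ℝ) ≤ x := by linarith
  set T : Set (ℕ × ℕ) := {p : ℕ × ℕ | 0 < p.1 ∧ 0 < p.2 ∧ p.1 + p.2 ≤ x ∧ ∀ q : ℕ, q.Prime →
      q ∣ p.1 * p.2 * (p.1 + p.2) → (q : ℝ) ≤ Real.log x ^ K} with hTdef
  -- a smooth solution whose primitive part has height `≥ x^{δ/4}`
  obtain ⟨p, hpT, hbig⟩ :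
      ∃ p ∈ T, (x : ℝ) ^ (δ / 4) ≤ (((p.1 + p.2) / Nat.gcd p.1 p.2 : ℕ) : ℝ) := by
    by_contra hcon
    push Not at hcon
    set z : ℕ := ⌊(x : ℝ) ^ (δ / 4)⌋₊ with hz
    have hA0 : (0 : ℝ) ≤ (x : ℝ) ^ (δ / 4) := by positivity
    have hA1 : (1 : ℝ) ≤ (x : ℝ) ^ (δ / 4) := Real.one_le_rpow hx1 (by positivity)
    have hzle : (z : ℝ) ≤ (x : ℝ) ^ (δ / 4) := Nat.floor_le hA0
    have hcount : T.ncard ≤ (z + 1) * ((z + 1) * (x + 1)) := by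
      refine ncard_le_of_height_div_gcd_le fun p hp => ⟨hp.1, hp.2.2.1, ?_⟩
      exact Nat.le_floor (hcon p hp).le
    have hsq : ((x : ℝ) ^ (δ / 4)) ^ 2 = (x : ℝ) ^ (δ / 2) := by
      rw [← Real.rpow_natCast, ← Real.rpow_mul hx0.le]
      norm_num
      ring_nf
    have hsplit : (x : ℝ) ^ (1 + δ) = x * ((x : ℝ) ^ (δ / 2) * (x : ℝ) ^ (δ / 2)) := by
      rw [Real.rpow_add hx0, Real.rpow_one, ← Real.rpow_add hx0]
      ring_nf
    have hreal : (x : ℝ) ^ (1 + δ) ≤ ((z : ℝ) + 1) ^ 2 * ((x : ℝ) + 1) := by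
      calc (x : ℝ) ^ (1 + δ) ≤ (T.ncard : ℝ) := hx
        _ ≤ (((z + 1) * ((z + 1) * (x + 1)) : ℕ) : ℝ) := by exact_mod_cast hcount
        _ = ((z : ℝ) + 1) ^ 2 * ((x : ℝ) + 1) := by push_cast; ring
    have hB : (x : ℝ) * ((x : ℝ) ^ (δ / 2) * (x : ℝ) ^ (δ / 2)) ≤
        (4 * (x : ℝ) ^ (δ / 2)) * (2 * x) := by
      rw [← hsplit]
      refine hreal.trans (mul_le_mul ?_ (by linarith) (by positivity) (by positivity))
      rw [← hsq]
      nlinarith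
    have hpos : (0 : ℝ) < x * (x : ℝ) ^ (δ / 2) := by positivity
    have : (x : ℝ) ^ (δ / 2) ≤ 8 := by
      have h' : (x * (x : ℝ) ^ (δ / 2)) * (x : ℝ) ^ (δ / 2) ≤ (x * (x : ℝ) ^ (δ / 2)) * 8 := by
        calc (x * (x : ℝ) ^ (δ / 2)) * (x : ℝ) ^ (δ / 2)
            = (x : ℝ) * ((x : ℝ) ^ (δ / 2) * (x : ℝ) ^ (δ / 2)) := by ring
          _ ≤ (4 * (x : ℝ) ^ (δ / 2)) * (2 * x) := hB
          _ = (x * (x : ℝ) ^ (δ / 2)) * 8 := by ring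
      exact le_of_mul_le_mul_left h' hpos
    linarith
  -- its primitive part is the abc triple we want
  obtain ⟨⟨a, b⟩, ⟨ha, hb, -, hsm⟩, hbig⟩ : ∃ p ∈ T,
      (x : ℝ) ^ (δ / 4) ≤ (((p.1 + p.2) / Nat.gcd p.1 p.2 : ℕ) : ℝ) := ⟨p, hpT, hbig⟩
  dsimp only at ha hb hsm hbig
  refine ⟨(a / Nat.gcd a b, b / Nat.gcd a b, (a + b) / Nat.gcd a b),
    ⟨isABCTriple_div_gcd ha hb, ?_⟩, ?_⟩
  · exact lt_rpow_log_of_le_log_pow hδ hε hx0 h1 h4 hbig (smoothness_div_gcd_le ha hb hsm)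
  · exact_mod_cast hN.trans_le hbig

end XYZ

/-- **Harper's Corollary 1 (weak counting form) ⟹ the finiteness half `XYZUpperHalf` of the xyz
conjecture** ("… and in particular is finite" [Harper2016, §1]): the named fact `XYZUpperHalf` of
`XYZConjecture.lean` reduces to a lower bound `x^{1+δ}` for the number of `(log x)^K`-smooth solutions
of `a + b = c` below `x`, for arbitrarily large `x`.
[cite: Harper2016, §1 (remark following Cor. 1: "… and in particular is finite")] -/
theorem xyzUpperHalf_of_frequently_le_ncard {K : ℕ} {δ : ℝ} (hδ : 0 < δ)
    (h : ∃ᶠ x : ℕ in atTop, (x : ℝ) ^ (1 + δ) ≤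
      ({p : ℕ × ℕ | 0 < p.1 ∧ 0 < p.2 ∧ p.1 + p.2 ≤ x ∧ ∀ q : ℕ, q.Prime →
        q ∣ p.1 * p.2 * (p.1 + p.2) → (q : ℝ) ≤ Real.log x ^ K}.ncard : ℝ)) :
    XYZUpperHalf :=
  (XYZ.exponentLE_of_frequently_le_ncard hδ h).xyzUpperHalf

/-! ### The finiteness half of the xyz conjecture (Harper's theorem) -/

/-- **`XYZUpperHalf` holds**: the xyz-smoothness exponent is finite, i.e. for some `κ` there are
infinitely many primitive `a + b = c` all of whose prime factors are `≤ (log c)^κ`. This is Harper's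
theorem [Harper2016, Cor. 1] (smooth solutions of `a + b = c` below `x` with `y = (log x)^K` are
`≫ Ψ(x,y)³/x`, hence `≥ x^{3/2}` for large `K`, along a sequence of `x → ∞`) — proved in the tree's
`Literature/NumberTheory/Sieve/Smooth*.lean` files (saddle point, minor arcs and restriction for
exponential sums over smooth numbers, major arcs at good levels, and the endgame
`Literature.NumberTheory.Sieve.Endgame.smooth_abc_pairs_frequently`) — combined with the reduction
`xyzUpperHalf_of_frequently_le_ncard` ([LagariasSoundararajan2011, Thm. 1.5]).
[cite: Harper2016, Cor. 1 and the remark following it] -/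
theorem XYZUpperHalf_holds : XYZUpperHalf := by
  obtain ⟨K, h⟩ := Literature.NumberTheory.Sieve.Endgame.smooth_abc_pairs_frequently
  exact xyzUpperHalf_of_frequently_le_ncard (K := K) (δ := 1 / 2) (by norm_num) h

end Literature.NumberTheory.DiophantineGeometry

end
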